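import Summits.NavierStokesRegularity.NavierStokesRegularity.Theorems.CoriolisHeadTypeIRateDyadicPressureKernel
import Summits.NavierStokesRegularity.NavierStokesRegularity.Theorems.CoriolisHeadTypeIRatePressureRate
import HarnessLib

/-!
# CoriolisHeadTypeIRateDyadicPressureRate — crux `NoCoRotatingCore` (stmt-NavierStokesRegularity-22676), line
# `far_field_constancy` v2 (skeleton 15c9a82ad206abb9), stub K1c `stub_typeIRate`:
# third door, pressure half 2/2 — the pressure-gradient rate with a DYADIC PROFILE

`TypeIRate.abs_fderiv_sub_inner_le_dyadic`: if `P` is smooth with `|ΔP(w)| ≤ θ_i/‖w‖²` for `‖w‖ ≥ 2^i` (`θ`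
nonnegative, nonincreasing) and `∇P → g` uniformly, then on the dyadic shell `2^k ≤ ‖y‖ ≤ 2^{k+1}` (`k ≥ 1`)
`|∂ₑP(y) − ⟪g,e⟫| ≤ Ψ_k ‖e‖/‖y‖` with the DYADIC PROFILE
`Ψ_k = 64 C_Γ |B₁| θ_{k−1} + 128 C_Γ ((4/3) I₁ 2^{−k} + (32/3)|B₁| 2^{−k} Σ_{i≤k} θ_i 2^i + 64 |B₁| θ_{k+1})`,
`I₁ = ∫_{|w|≤1}|ΔP|`, whose partial sums are bounded by `const·(I₁ + |B₁| Σ θ_i)` (tree `sum_range_weighted_le_two_mul`).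
Same centred dyadic telescoping as the landed `abs_fderiv_sub_inner_le` (global power bound), with the small scales fed
by the far-field value `θ_{k−1}` and the large scales by the dyadic-shell ball integrals of
`CoriolisHeadTypeIRateDyadicPressureKernel`.  With a square-summable modulus in K1a (`θ_i` summable) this is the
summable forcing profile that the chained spiral transport (`CoriolisHeadTypeIRateDyadicTransport`) turns into the pure
Type-I rate — the third door to K1c (memo K1C-REDUCTION-v4).  Nothing here proves K1c, `NoCoRotatingCore` or NS
regularity.

References: line card `Cruxes/NoCoRotatingCore/Lines/far_field_constancy.md` (K1c block); D. Gilbarg, N. S. Trudinger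
(2001) §4.2 [GilbargTrudinger2001].
-/

noncomputable section

open MeasureTheory Set Function Filter Topology Metric InnerProductSpace Real
open scoped RealInnerProductSpace BigOperators Laplacian ContDiff

-- the summit and its single sub-problem share the name (CONVENTIONS §1), as in every Theorems file
set_option linter.dupNamespace false

namespace Summit.NavierStokesRegularity.NavierStokesRegularity.Theorems.CoriolisHead

namespace TypeIRate

open Literature.Analysis.FluidPDE

/-- The large-scale summation: with `J(K) = I₁ + 8V₁ Σ_{i<K} θ_i 2^i` and `θ` nonincreasing,
`Σ_{N<N₂} 4^{−N} J(k+N+2) ≤ (4/3) I₁ + (32/3) V₁ Σ_{i≤k} θ_i 2^i + 64 V₁ 2^k θ_{k+1}`. -/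
theorem sum_quarter_pow_dyadic_le {θ : ℕ → ℝ} (hθ : ∀ i, 0 ≤ θ i) (hanti : Antitone θ) {I₁ V₁ : ℝ}
    (hI₁ : 0 ≤ I₁) (hV₁ : 0 ≤ V₁) (k N₂ : ℕ) :
    ∑ N ∈ Finset.range N₂, (1 / 4 : ℝ) ^ N *
        (I₁ + 8 * V₁ * ∑ i ∈ Finset.range (k + N + 2), θ i * 2 ^ i) ≤
      4 / 3 * I₁ + 32 / 3 * V₁ * (∑ i ∈ Finset.range (k + 1), θ i * 2 ^ i) + 64 * V₁ * 2 ^ k * θ (k + 1) := by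
  set A : ℝ := ∑ i ∈ Finset.range (k + 1), θ i * 2 ^ i with hA
  have hA0 : 0 ≤ A := Finset.sum_nonneg fun i _ => by have := hθ i; positivity
  -- per-term bound on `J(k+N+2)`
  have hJ : ∀ N : ℕ, I₁ + 8 * V₁ * ∑ i ∈ Finset.range (k + N + 2), θ i * 2 ^ i ≤
      I₁ + 8 * V₁ * A + 32 * V₁ * θ (k + 1) * 2 ^ k * 2 ^ N := by
    intro N
    have hsplit : ∑ i ∈ Finset.range (k + N + 2), θ i * 2 ^ i =
        A + ∑ j ∈ Finset.range (N + 1), θ (k + 1 + j) * 2 ^ (k + 1 + j) := by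
      have h := Finset.sum_Ico_consecutive (fun i => θ i * 2 ^ i) (Nat.zero_le (k + 1))
        (show k + 1 ≤ k + N + 2 by omega)
      rw [← Finset.range_eq_Ico, ← Finset.range_eq_Ico, Finset.sum_Ico_eq_sum_range,
        show k + N + 2 - (k + 1) = N + 1 by omega] at h
      rw [hA, ← h]
    have htail : ∑ j ∈ Finset.range (N + 1), θ (k + 1 + j) * 2 ^ (k + 1 + j) ≤
        θ (k + 1) * 2 ^ (k + 1) * 2 ^ (N + 1) := by
      have h1 : ∀ j ∈ Finset.range (N + 1), θ (k + 1 + j) * 2 ^ (k + 1 + j) ≤ θ (k + 1) * 2 ^ (k + 1) * 2 ^ j := by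
        intro j _
        have hmono : θ (k + 1 + j) ≤ θ (k + 1) := hanti (Nat.le_add_right _ _)
        rw [pow_add]
        have : 0 ≤ (2 : ℝ) ^ (k + 1) * 2 ^ j := by positivity
        nlinarith
      refine (Finset.sum_le_sum h1).trans ?_
      rw [← Finset.mul_sum]
      have hgeom : ∑ j ∈ Finset.range (N + 1), (2 : ℝ) ^ j ≤ 2 ^ (N + 1) := by
        rw [geom_sum_eq (by norm_num : (2 : ℝ) ≠ 1)]
        norm_num
      exact mul_le_mul_of_nonneg_left hgeom (by have := hθ (k + 1); positivity)
    rw [hsplit, mul_add]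
    have h8 : 8 * V₁ * (θ (k + 1) * 2 ^ (k + 1) * 2 ^ (N + 1)) = 32 * V₁ * θ (k + 1) * 2 ^ k * 2 ^ N := by
      rw [pow_succ, pow_succ]; ring
    nlinarith [mul_le_mul_of_nonneg_left htail (by positivity : (0 : ℝ) ≤ 8 * V₁)]
  -- sum the geometric series
  obtain ⟨hhalf, hquarter⟩ := sum_range_half_pow_le N₂
  have hterm : ∀ N ∈ Finset.range N₂, (1 / 4 : ℝ) ^ N *
      (I₁ + 8 * V₁ * ∑ i ∈ Finset.range (k + N + 2), θ i * 2 ^ i) ≤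
      (I₁ + 8 * V₁ * A) * (1 / 4 : ℝ) ^ N + 32 * V₁ * θ (k + 1) * 2 ^ k * (1 / 2 : ℝ) ^ N := by
    intro N _
    have h := mul_le_mul_of_nonneg_left (hJ N) (by positivity : (0 : ℝ) ≤ (1 / 4 : ℝ) ^ N)
    have e : (1 / 4 : ℝ) ^ N * 2 ^ N = (1 / 2 : ℝ) ^ N := by rw [← mul_pow]; norm_num
    have e2 : (1 / 4 : ℝ) ^ N * (I₁ + 8 * V₁ * A + 32 * V₁ * θ (k + 1) * 2 ^ k * 2 ^ N) =
        (I₁ + 8 * V₁ * A) * (1 / 4 : ℝ) ^ N + 32 * V₁ * θ (k + 1) * 2 ^ k * ((1 / 4 : ℝ) ^ N * 2 ^ N) := by ring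
    rw [e2, e] at h
    exact h
  refine (Finset.sum_le_sum hterm).trans ?_
  rw [Finset.sum_add_distrib, ← Finset.mul_sum, ← Finset.mul_sum]
  have h1 : (I₁ + 8 * V₁ * A) * ∑ N ∈ Finset.range N₂, (1 / 4 : ℝ) ^ N ≤ (I₁ + 8 * V₁ * A) * (4 / 3) :=
    mul_le_mul_of_nonneg_left hquarter (by positivity)
  have h2 : 32 * V₁ * θ (k + 1) * 2 ^ k * ∑ N ∈ Finset.range N₂, (1 / 2 : ℝ) ^ N ≤
      32 * V₁ * θ (k + 1) * 2 ^ k * 2 :=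
    mul_le_mul_of_nonneg_left hhalf (by have := hθ (k + 1); positivity)
  nlinarith

/-- **Pressure-gradient rate with a dyadic profile, raw form** (small-scale part `A₁c₀`, large-scale part `U`; see
`abs_fderiv_sub_inner_le_dyadic` for the profile form). [folklore; cite: GilbargTrudinger2001, §4.2] -/
theorem abs_fderiv_sub_inner_le_dyadic_raw {C : ℝ} (hC0 : 0 ≤ C)
    (hC : ∀ w : EuclideanSpace ℝ (Fin 3), ‖w‖ ^ 2 * ‖fderiv ℝ (newtonFar 1 2) w‖ ≤ C)
    {P : EuclideanSpace ℝ (Fin 3) → ℝ} (hP : ContDiff ℝ ∞ P) {θ : ℕ → ℝ} (hθ : ∀ i, 0 ≤ θ i)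
    (hanti : Antitone θ)
    (hΔ : ∀ (i : ℕ) (w : EuclideanSpace ℝ (Fin 3)), (2 : ℝ) ^ i ≤ ‖w‖ → |(Δ P) w| ≤ θ i / ‖w‖ ^ 2)
    {g : EuclideanSpace ℝ (Fin 3)}
    (hg : ∀ ε : ℝ, 0 < ε → ∃ R : ℝ, ∀ w : EuclideanSpace ℝ (Fin 3), R ≤ ‖w‖ → ‖gradient P w - g‖ ≤ ε)
    {k : ℕ} (hk : 1 ≤ k) (y : EuclideanSpace ℝ (Fin 3)) (hy1 : (2 : ℝ) ^ k ≤ ‖y‖) (hy2 : ‖y‖ ≤ (2 : ℝ) ^ (k + 1))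
    (e : EuclideanSpace ℝ (Fin 3)) :
    |fderiv ℝ P y e - ⟪g, e⟫| ≤
      512 * C * (volume (ball (0 : EuclideanSpace ℝ (Fin 3)) 1)).toReal * θ (k - 1) * ‖e‖ / ‖y‖ ^ 2 * (‖y‖ / 8) +
        128 * C * ‖e‖ / ‖y‖ ^ 2 * (4 / 3 * (∫ w in closedBall (0 : EuclideanSpace ℝ (Fin 3)) 1, |(Δ P) w|) +
          32 / 3 * (volume (ball (0 : EuclideanSpace ℝ (Fin 3)) 1)).toReal *
            (∑ i ∈ Finset.range (k + 1), θ i * 2 ^ i) +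
          64 * (volume (ball (0 : EuclideanSpace ℝ (Fin 3)) 1)).toReal * 2 ^ k * θ (k + 1)) := by
  obtain ⟨V₁, hV₁⟩ : ∃ V : ℝ, V = (volume (ball (0 : EuclideanSpace ℝ (Fin 3)) 1)).toReal := ⟨_, rfl⟩
  have hV₁0 : 0 ≤ V₁ := by rw [hV₁]; exact ENNReal.toReal_nonneg
  rw [← hV₁]
  obtain ⟨I₁, hI₁⟩ : ∃ I : ℝ, I = ∫ w in closedBall (0 : EuclideanSpace ℝ (Fin 3)) 1, |(Δ P) w| := ⟨_, rfl⟩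
  have hI₁0 : 0 ≤ I₁ := by rw [hI₁]; exact integral_nonneg fun _ => abs_nonneg _
  rw [← hI₁]
  have hP2 : ContDiff ℝ 2 P := hP.of_le (by norm_cast)
  have h2k : (0 : ℝ) < 2 ^ k := pow_pos two_pos k
  have hypos : 0 < ‖y‖ := h2k.trans_le hy1
  set A : ℝ := ∑ i ∈ Finset.range (k + 1), θ i * 2 ^ i with hA
  have hA0 : 0 ≤ A := Finset.sum_nonneg fun i _ => by have := hθ i; positivity
  -- the centred shell means
  obtain ⟨S, hS⟩ : ∃ S : ℝ → ℝ, ∀ c, S c = ∫ z, newtonFarLaplacian c (2 * c) z * fderiv ℝ P (y + z) e :=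
    ⟨_, fun _ => rfl⟩
  set c₀ : ℝ := ‖y‖ / 8 with hc₀
  have hc₀pos : 0 < c₀ := by positivity
  have hc₀y : 8 * c₀ = ‖y‖ := by rw [hc₀]; ring
  -- far-field bound beyond `‖y‖/2 ≥ 2^{k-1}`
  have hfar : ∀ w : EuclideanSpace ℝ (Fin 3), ‖y‖ / 2 ≤ ‖w‖ → |(Δ P) w| ≤ θ (k - 1) / ‖w‖ ^ 2 := by
    intro w hw
    refine hΔ (k - 1) w (le_trans ?_ hw)
    have h2 : (2 : ℝ) ^ k = 2 ^ (k - 1) * 2 := by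
      rw [← pow_succ, Nat.sub_add_cancel hk]
    rw [h2] at hy1
    linarith
  -- the two step bounds
  set A₁ : ℝ := 512 * C * V₁ * θ (k - 1) * ‖e‖ / ‖y‖ ^ 2 with hA₁
  have hA₁0 : 0 ≤ A₁ := by have := hθ (k - 1); positivity
  have hsmall : ∀ c : ℝ, 0 < c → 8 * c ≤ ‖y‖ → |S c - S (2 * c)| ≤ A₁ * c := by
    intro c hc hcy
    have h := abs_shellStep_le_dyadic_small hC0 hC hP (hθ (k - 1)) y e hfar hc hcy
    rw [← hV₁] at h
    rw [hS, hS, show 2 * (2 * c) = 4 * c by ring]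
    refine h.trans (le_of_eq ?_)
    rw [hA₁]
    field_simp
  obtain ⟨L, hL⟩ : ∃ L : ℝ, L = 128 * C * ‖e‖ / ‖y‖ ^ 2 := ⟨_, rfl⟩
  have hL0 : 0 ≤ L := by rw [hL]; positivity
  have hlarge : ∀ N : ℕ, |S (c₀ * 2 ^ N) - S (c₀ * 2 ^ (N + 1))| ≤
      L * ((1 / 4 : ℝ) ^ N * (I₁ + 8 * V₁ * ∑ i ∈ Finset.range (k + N + 2), θ i * 2 ^ i)) := by
    intro N
    have hc : 0 < c₀ * 2 ^ N := by positivity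
    have h1 := abs_shellStep_le hC0 hC hP y e hc
    rw [hS, hS, show c₀ * 2 ^ (N + 1) = 2 * (c₀ * 2 ^ N) by rw [pow_succ]; ring,
      show (2 : ℝ) * (2 * (c₀ * 2 ^ N)) = 4 * (c₀ * 2 ^ N) by ring]
    -- the ball integral: translate, enlarge to radius `2^{k+N+2}`, dyadic shells
    have hrad : 4 * (c₀ * 2 ^ N) + ‖y‖ ≤ (2 : ℝ) ^ (k + N + 2) := by
      rw [hc₀]
      have h1N : (1 : ℝ) ≤ 2 ^ N := one_le_pow₀ one_le_two
      have e1 : (2 : ℝ) ^ (k + N + 2) = 2 ^ (k + 1) * 2 ^ N * 2 := by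
        rw [show k + N + 2 = (k + 1) + N + 1 by ring, pow_succ, pow_add]
      rw [e1]
      have hp : (0 : ℝ) < 2 ^ (k + 1) := by positivity
      nlinarith
    have hball := (setIntegral_abs_laplacian_translate_le hP2 y (4 * (c₀ * 2 ^ N))).trans
      ((setIntegral_abs_laplacian_mono hP2 hrad).trans (setIntegral_abs_laplacian_two_pow_le hP2 hθ hΔ (k + N + 2)))
    rw [← hV₁, ← hI₁] at hball
    have hpos : 0 ≤ 2 * C * ‖e‖ / (c₀ * 2 ^ N) ^ 2 := by positivity
    refine h1.trans ((mul_le_mul_of_nonneg_left hball hpos).trans (le_of_eq ?_))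
    rw [hL, hc₀]
    have e4 : (1 / 4 : ℝ) ^ N = 1 / (2 ^ N) ^ 2 := by
      rw [one_div_pow, ← pow_mul, mul_comm, pow_mul]; norm_num
    rw [e4]
    field_simp
    ring
  -- downward telescoping
  have hdown : ∀ N : ℕ, |S (c₀ / 2 ^ N) - S c₀| ≤ A₁ * (c₀ - c₀ / 2 ^ N) := by
    intro N
    induction N with
    | zero => simp
    | succ N ih =>
      have hc : 0 < c₀ / 2 ^ (N + 1) := by positivity
      have h2c : 2 * (c₀ / 2 ^ (N + 1)) = c₀ / 2 ^ N := by
        rw [pow_succ]; field_simp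
      have h8c : 8 * (c₀ / 2 ^ (N + 1)) ≤ ‖y‖ := by
        rw [← hc₀y]
        have h1 : (1 : ℝ) ≤ 2 ^ (N + 1) := one_le_pow₀ one_le_two
        have : c₀ / 2 ^ (N + 1) ≤ c₀ := div_le_self hc₀pos.le h1
        linarith
      have hstep := hsmall _ hc h8c
      rw [h2c] at hstep
      have htri : |S (c₀ / 2 ^ (N + 1)) - S c₀| ≤
          |S (c₀ / 2 ^ (N + 1)) - S (c₀ / 2 ^ N)| + |S (c₀ / 2 ^ N) - S c₀| := abs_sub_le _ _ _
      have hgeom : c₀ / 2 ^ N - c₀ / 2 ^ (N + 1) = c₀ / 2 ^ (N + 1) := by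
        rw [pow_succ]; field_simp; ring
      nlinarith [hgeom]
  -- upward telescoping
  have hup : ∀ N₂ : ℕ, |S c₀ - S (c₀ * 2 ^ N₂)| ≤
      L * ∑ N ∈ Finset.range N₂, (1 / 4 : ℝ) ^ N *
        (I₁ + 8 * V₁ * ∑ i ∈ Finset.range (k + N + 2), θ i * 2 ^ i) := by
    intro N₂
    induction N₂ with
    | zero => simp
    | succ N₂ ih =>
      have hstep := hlarge N₂
      have htri : |S c₀ - S (c₀ * 2 ^ (N₂ + 1))| ≤
          |S c₀ - S (c₀ * 2 ^ N₂)| + |S (c₀ * 2 ^ N₂) - S (c₀ * 2 ^ (N₂ + 1))| := abs_sub_le _ _ _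
      rw [Finset.sum_range_succ, mul_add]
      linarith
  have hupB : ∀ N₂ : ℕ, |S c₀ - S (c₀ * 2 ^ N₂)| ≤
      L * (4 / 3 * I₁ + 32 / 3 * V₁ * A + 64 * V₁ * 2 ^ k * θ (k + 1)) := fun N₂ =>
    (hup N₂).trans (mul_le_mul_of_nonneg_left (sum_quarter_pow_dyadic_le hθ hanti hI₁0 hV₁0 k N₂) hL0)
  -- the downward limit: approximate identity
  have hφc : Continuous fun z : EuclideanSpace ℝ (Fin 3) => fderiv ℝ P (y + z) e :=
    ((hP.continuous_fderiv (by simp)).comp (continuous_const.add continuous_id)).clm_apply continuous_const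
  have hlim_down : Tendsto (fun N : ℕ => S (c₀ / 2 ^ N)) atTop (𝓝 (fderiv ℝ P y e)) := by
    have hT := tendsto_integral_newtonFarLaplacian_smul one_pos one_lt_two hφc
    simp only [add_zero] at hT
    have hseq : Tendsto (fun N : ℕ => c₀ / 2 ^ N) atTop (𝓝[>] (0 : ℝ)) := by
      refine tendsto_nhdsWithin_iff.2 ⟨?_, Eventually.of_forall fun N => ?_⟩
      · have h := (tendsto_pow_atTop_nhds_zero_of_lt_one (by norm_num : (0 : ℝ) ≤ 1 / 2)
          (by norm_num : (1 : ℝ) / 2 < 1)).const_mul c₀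
        rw [mul_zero] at h
        refine h.congr fun N => ?_
        rw [one_div, inv_pow, div_eq_mul_inv]
      · exact mem_Ioi.2 (by positivity)
    have h := hT.comp hseq
    refine h.congr fun N => ?_
    simp only [Function.comp, smul_eq_mul, mul_one, hS]
    congr 1
    funext z
    rw [mul_comm (c₀ / 2 ^ N) 2]
  -- the upward limit: `∇P → g` on far shells
  have hlim_up : ∀ ε : ℝ, 0 < ε → ∃ N₀ : ℕ, ∀ N, N₀ ≤ N →
      |S (c₀ * 2 ^ N) - ⟪g, e⟫| ≤ (∫ w : EuclideanSpace ℝ (Fin 3), |newtonFarLaplacian 1 2 w|) * (ε * ‖e‖) := by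
    intro ε hε
    obtain ⟨Rg, hRg⟩ := hg ε hε
    obtain ⟨N₀, hN₀⟩ := pow_unbounded_of_one_lt ((Rg + ‖y‖) / c₀) (one_lt_two : (1 : ℝ) < 2)
    refine ⟨N₀, fun N hN => ?_⟩
    have hc : 0 < c₀ * 2 ^ N := by positivity
    have hcR : Rg + ‖y‖ ≤ c₀ * 2 ^ N := by
      have h1 : (Rg + ‖y‖) / c₀ < 2 ^ N :=
        hN₀.trans_le (pow_le_pow_right₀ one_le_two hN)
      rw [div_lt_iff₀ hc₀pos] at h1
      linarith
    rw [hS]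
    refine abs_shellMean_sub_le hc hφc fun z hz1 _ => ?_
    rw [show fderiv ℝ P (y + z) e = ⟪gradient P (y + z), e⟫ by
      rw [gradient, InnerProductSpace.toDual_symm_apply], ← inner_sub_left]
    have hyz : Rg ≤ ‖y + z‖ := by
      have h := norm_sub_norm_le z (-y)
      have : ‖z - -y‖ = ‖y + z‖ := by rw [sub_neg_eq_add, add_comm]
      rw [this, norm_neg] at h
      linarith
    calc |⟪gradient P (y + z) - g, e⟫| ≤ ‖gradient P (y + z) - g‖ * ‖e‖ := abs_real_inner_le_norm _ _
      _ ≤ ε * ‖e‖ := mul_le_mul_of_nonneg_right (hRg _ hyz) (norm_nonneg _)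
  -- assembling
  set Λ₁ : ℝ := ∫ w : EuclideanSpace ℝ (Fin 3), |newtonFarLaplacian 1 2 w| with hΛ₁
  have hΛ₁0 : 0 ≤ Λ₁ := integral_nonneg fun _ => abs_nonneg _
  obtain ⟨U, hU⟩ : ∃ U : ℝ, U = L * (4 / 3 * I₁ + 32 / 3 * V₁ * A + 64 * V₁ * 2 ^ k * θ (k + 1)) := ⟨_, rfl⟩
  have hupB' : ∀ N₂ : ℕ, |S c₀ - S (c₀ * 2 ^ N₂)| ≤ U := fun N₂ => by rw [hU]; exact hupB N₂
  have hgoal : A₁ * c₀ + U = 512 * C * V₁ * θ (k - 1) * ‖e‖ / ‖y‖ ^ 2 * (‖y‖ / 8) +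
      128 * C * ‖e‖ / ‖y‖ ^ 2 * (4 / 3 * I₁ + 32 / 3 * V₁ * A + 64 * V₁ * 2 ^ k * θ (k + 1)) := by
    rw [hA₁, hc₀, hU, hL]
  rw [← hgoal]
  refine le_of_forall_pos_le_add fun ε hε => ?_
  set ε' : ℝ := ε / (2 * (1 + Λ₁ * ‖e‖)) with hε'
  have hε'pos : 0 < ε' := by positivity
  obtain ⟨N₁, hN₁⟩ := (Metric.tendsto_atTop.1 hlim_down) ε' hε'pos
  obtain ⟨N₂, hN₂⟩ := hlim_up ε' hε'pos
  have h1 : |fderiv ℝ P y e - S (c₀ / 2 ^ N₁)| ≤ ε' := by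
    rw [abs_sub_comm]; exact le_of_lt (hN₁ N₁ le_rfl)
  have h2 := hdown N₁
  have h3 := hupB' N₂
  have h4 := hN₂ N₂ le_rfl
  have h2' : |S (c₀ / 2 ^ N₁) - S c₀| ≤ A₁ * c₀ := by
    refine h2.trans (mul_le_mul_of_nonneg_left ?_ hA₁0)
    have : 0 ≤ c₀ / 2 ^ N₁ := by positivity
    linarith
  have hεsum : ε' + Λ₁ * (ε' * ‖e‖) ≤ ε := by
    rw [hε']
    have hden : 0 < 2 * (1 + Λ₁ * ‖e‖) := by positivity
    rw [show ε / (2 * (1 + Λ₁ * ‖e‖)) + Λ₁ * (ε / (2 * (1 + Λ₁ * ‖e‖)) * ‖e‖) =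
      ε * ((1 + Λ₁ * ‖e‖) / (2 * (1 + Λ₁ * ‖e‖))) by field_simp]
    rw [show (1 + Λ₁ * ‖e‖) / (2 * (1 + Λ₁ * ‖e‖)) = 1 / 2 by field_simp]
    linarith
  have htri : |fderiv ℝ P y e - ⟪g, e⟫| ≤ |fderiv ℝ P y e - S (c₀ / 2 ^ N₁)| +
      |S (c₀ / 2 ^ N₁) - S c₀| + |S c₀ - S (c₀ * 2 ^ N₂)| + |S (c₀ * 2 ^ N₂) - ⟪g, e⟫| := by
    have t1 := abs_sub_le (fderiv ℝ P y e) (S (c₀ / 2 ^ N₁)) ⟪g, e⟫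
    have t2 := abs_sub_le (S (c₀ / 2 ^ N₁)) (S c₀) ⟪g, e⟫
    have t3 := abs_sub_le (S c₀) (S (c₀ * 2 ^ N₂)) ⟪g, e⟫
    linarith
  linarith

/-- **Pressure-gradient rate with a dyadic profile** (see the module docstring). [folklore; cite: GilbargTrudinger2001, §4.2] -/
theorem abs_fderiv_sub_inner_le_dyadic {C : ℝ} (hC0 : 0 ≤ C)
    (hC : ∀ w : EuclideanSpace ℝ (Fin 3), ‖w‖ ^ 2 * ‖fderiv ℝ (newtonFar 1 2) w‖ ≤ C)
    {P : EuclideanSpace ℝ (Fin 3) → ℝ} (hP : ContDiff ℝ ∞ P) {θ : ℕ → ℝ} (hθ : ∀ i, 0 ≤ θ i)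
    (hanti : Antitone θ)
    (hΔ : ∀ (i : ℕ) (w : EuclideanSpace ℝ (Fin 3)), (2 : ℝ) ^ i ≤ ‖w‖ → |(Δ P) w| ≤ θ i / ‖w‖ ^ 2)
    {g : EuclideanSpace ℝ (Fin 3)}
    (hg : ∀ ε : ℝ, 0 < ε → ∃ R : ℝ, ∀ w : EuclideanSpace ℝ (Fin 3), R ≤ ‖w‖ → ‖gradient P w - g‖ ≤ ε)
    {k : ℕ} (hk : 1 ≤ k) (y : EuclideanSpace ℝ (Fin 3)) (hy1 : (2 : ℝ) ^ k ≤ ‖y‖) (hy2 : ‖y‖ ≤ (2 : ℝ) ^ (k + 1))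
    (e : EuclideanSpace ℝ (Fin 3)) :
    |fderiv ℝ P y e - ⟪g, e⟫| ≤
      (64 * C * (volume (ball (0 : EuclideanSpace ℝ (Fin 3)) 1)).toReal * θ (k - 1) +
        128 * C * (4 / 3 * (∫ w in closedBall (0 : EuclideanSpace ℝ (Fin 3)) 1, |(Δ P) w|) / 2 ^ k +
          32 / 3 * (volume (ball (0 : EuclideanSpace ℝ (Fin 3)) 1)).toReal *
            (∑ i ∈ Finset.range (k + 1), θ i * 2 ^ i) / 2 ^ k +
          64 * (volume (ball (0 : EuclideanSpace ℝ (Fin 3)) 1)).toReal * θ (k + 1))) / ‖y‖ * ‖e‖ := by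
  obtain ⟨V₁, hV₁⟩ : ∃ V : ℝ, V = (volume (ball (0 : EuclideanSpace ℝ (Fin 3)) 1)).toReal := ⟨_, rfl⟩
  have hV₁0 : 0 ≤ V₁ := by rw [hV₁]; exact ENNReal.toReal_nonneg
  rw [← hV₁]
  obtain ⟨I₁, hI₁⟩ : ∃ I : ℝ, I = ∫ w in closedBall (0 : EuclideanSpace ℝ (Fin 3)) 1, |(Δ P) w| := ⟨_, rfl⟩
  have hI₁0 : 0 ≤ I₁ := by rw [hI₁]; exact integral_nonneg fun _ => abs_nonneg _
  rw [← hI₁]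
  have h := abs_fderiv_sub_inner_le_dyadic_raw hC0 hC hP hθ hanti hΔ hg hk y hy1 hy2 e
  rw [← hV₁, ← hI₁] at h
  have h2k : (0 : ℝ) < 2 ^ k := pow_pos two_pos k
  have hypos : 0 < ‖y‖ := h2k.trans_le hy1
  obtain ⟨A, hA⟩ : ∃ A : ℝ, A = ∑ i ∈ Finset.range (k + 1), θ i * 2 ^ i := ⟨_, rfl⟩
  have hA0 : 0 ≤ A := by rw [hA]; exact Finset.sum_nonneg fun i _ => by have := hθ i; positivity
  rw [← hA] at h ⊢
  refine h.trans ?_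
  have hθk : 0 ≤ θ (k + 1) := hθ (k + 1)
  have hθk1 : 0 ≤ θ (k - 1) := hθ (k - 1)
  -- `1/‖y‖² ≤ 1/(2^k ‖y‖)` and `2^k/‖y‖² ≤ 1/‖y‖`
  have hyy : 2 ^ k * ‖y‖ ≤ ‖y‖ ^ 2 := by
    rw [sq]; exact mul_le_mul_of_nonneg_right hy1 hypos.le
  have hy2k : 1 / ‖y‖ ^ 2 ≤ 1 / (2 ^ k * ‖y‖) :=
    one_div_le_one_div_of_le (by positivity) hyy
  have h3 : 2 ^ k * (1 / ‖y‖ ^ 2) ≤ 1 / ‖y‖ := by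
    rw [mul_one_div, div_le_div_iff₀ (pow_pos hypos 2) hypos, one_mul]
    exact hyy
  have hq : 0 ≤ 4 / 3 * I₁ + 32 / 3 * V₁ * A := by positivity
  have i1 := mul_le_mul_of_nonneg_left hy2k hq
  have i2 := mul_le_mul_of_nonneg_left h3 (by positivity : (0 : ℝ) ≤ 64 * V₁ * θ (k + 1))
  have i3 := mul_le_mul_of_nonneg_left (add_le_add i1 i2) (by positivity : (0 : ℝ) ≤ 128 * C * ‖e‖)
  have e0 : 512 * C * V₁ * θ (k - 1) * ‖e‖ / ‖y‖ ^ 2 * (‖y‖ / 8) = 64 * C * V₁ * θ (k - 1) / ‖y‖ * ‖e‖ := by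
    field_simp; ring
  have e1 : 128 * C * ‖e‖ / ‖y‖ ^ 2 * (4 / 3 * I₁ + 32 / 3 * V₁ * A + 64 * V₁ * 2 ^ k * θ (k + 1)) =
      128 * C * ‖e‖ * ((4 / 3 * I₁ + 32 / 3 * V₁ * A) * (1 / ‖y‖ ^ 2) +
        64 * V₁ * θ (k + 1) * (2 ^ k * (1 / ‖y‖ ^ 2))) := by ring
  have e2 : (64 * C * V₁ * θ (k - 1) +
      128 * C * (4 / 3 * I₁ / 2 ^ k + 32 / 3 * V₁ * A / 2 ^ k + 64 * V₁ * θ (k + 1))) / ‖y‖ * ‖e‖ =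
      64 * C * V₁ * θ (k - 1) / ‖y‖ * ‖e‖ +
      128 * C * ‖e‖ * ((4 / 3 * I₁ + 32 / 3 * V₁ * A) * (1 / (2 ^ k * ‖y‖)) +
        64 * V₁ * θ (k + 1) * (1 / ‖y‖)) := by
    field_simp
  rw [e0, e1, e2]
  linarith

end TypeIRate

end Summit.NavierStokesRegularity.NavierStokesRegularity.Theorems.CoriolisHead

end
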